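import Literature.NumberTheory.GaloisRepresentations.LubinTateColemanCoordMomentsCoinvariantTwo
import HarnessLib

/-!
# On the `ε`-coinvariants `M/(σ_{−1} − ε)M ≅ Λ` of the Coleman coordinate module (`q = 2`) EVERY unit twist `σ_v` acts as a SCALAR
# `t_v^ε := φ_ε(σ_v 1) ∈ Λ` (`φ_ε(σ_v r) = t_v^ε · φ_ε(r)`), with `t_γ = 1 + T`, `t_{−1} = ε`, `t_{vv′} = t_v t_{v′}`, `t_v(γ^{k+1} − 1) = v^{k+1}`;
# hence de Shalit's relation `e(𝔞)^{σ_𝔠 − N𝔠} = e(𝔠)^{σ_𝔞 − N𝔞}` becomes `(t_𝔠 − N𝔠)·φ_ε(x_𝔞) = (t_𝔞 − N𝔞)·φ_ε(x_𝔠)` in `Λ` and DIVIDES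

De Shalit, *Iwasawa theory of elliptic curves with complex multiplication* (1987), Ch. I §3.1 (`ℤ_p⟦𝒢⟧ = Λ[Δ]`: a group element `σ`
is the scalar `χ(σ|Δ)·(1+S)^{α(σ)}` on each `χ`-part), II §2.4 (ii) (`e(𝔞)^{σ_𝔠 − N𝔠} = e(𝔠)^{σ_𝔞 − N𝔞}`), II §4.12 (29)–(33) (`μ_𝔠 = (σ_𝔠 − N𝔠)·μ(𝔣)`:
division of the cocycle `𝔞 ↦ μ_𝔞 = i(e(𝔞))` by `σ_{𝔞₁} − N𝔞₁`), III §1.8 (14)–(15), §1.10 (17).  The tree (q = 2, one prime, series side):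
`colemanDeltaCoinvFun ε = φ_ε : M →ₗ Λ` with `M/(σ_{−1} − ε)M ≃ₗ Λ` (`LubinTateColemanCoordCoinvariantsTwo`), the `Λ`-linear unit twists `σ_v`
(`unitTwistₗ`, `LubinTateColemanCoordModuleTwo`), and the moments through the coinvariants (`coordMoment_eq_tEval_colemanDeltaCoinvFun`,
`LubinTateColemanCoordMomentsCoinvariantTwo`).  THIS file (everything PROVED, 0 sorry, no definitions):

* §1 (generic: basis `b : Fin 2`, involution data `τ b₀ = b₁`, `τ b₁ = b₀`, `ε² = 1`) `deltaCoinvFun_apply_tau` (`φ_ε(τ m) = ε φ_ε(m)`),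
  ★ `deltaCoinvFun_apply_of_comm` — **an `R`-linear `L` COMMUTING WITH `τ` acts on `φ_ε` as the scalar `φ_ε(L b₀)`**: `φ_ε(L m) = φ_ε(L b₀)·φ_ε(m)`;
* §2 (Coleman module over any base `S`) ★★ `colemanDeltaCoinvFun_unitTwistₗ` — **`φ_ε(σ_v r) = φ_ε(σ_v 1) · φ_ε(r)`** for every `v ∈ 𝒪_F^×`;
  the scalars `t_v^ε = φ_ε(σ_v 1)`: `…_unitTwistₗ_one_one` (`t_1 = 1`), `…_neg_one_one` (`t_{−1} = ε`), ★ `…_self_one` (`t_γ = 1 + T`), `…_pow_one`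
  (`t_{γ^n} = (1+T)^n`), `…_mul_one` (`t_{vv′} = t_v t_{v′}`), `colemanDeltaCoinvFun_unitTwistₗ_sub_smul` (`φ_ε((σ_v − N) r) = (t_v − N)·φ_ε(r)`);
* §3 (`S = 𝒪_E`) ★ `tEval_colemanDeltaCoinvFun_unitTwistₗ_one_mul` — **`t_v^ε(a_k) · mom_k(1) = v^{k+1} · mom_k(1)`**, `ε = (−1)^{k+1}` (so `t_v(a_k) = v^{k+1}`
  wherever `mom_k(1)` is a non-zero-divisor: `tEval_colemanDeltaCoinvFun_unitTwistₗ_one`);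
* §4 ★★ THE COCYCLE RELATION IN `Λ` AND ITS DIVISION (de Shalit II §4.12 on the series side): for `x : I → M`, `v : I → 𝒪_F^×`, `N : I → Λ` with
  **`σ_{v c}(x a) + N a • x c = σ_{v a}(x c) + N c • x a`** (II §2.4 (ii), additively): `colemanDeltaCoinvFun_cocycle`
  (**`(t_{v c} − N c)·φ_ε(x a) = (t_{v a} − N a)·φ_ε(x c)`**), ★★ `colemanDeltaCoinvFun_eq_mul_of_divides` — **if `φ_ε(x a₁) = (t_{a₁} − N a₁)·L` for ONE
  index `a₁` with `t_{a₁} − N a₁` a non-zero-divisor, then `φ_ε(x c) = (t_c − N c)·L` for EVERY `c`** ((32)–(33): `μ_𝔠 = (σ_𝔠 − N𝔠)μ`; `L` is unique by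
  cancellation of the non-zero-divisor), and `colemanDeltaCoinvFun_map_span_range_eq_span_mul` (**`φ_ε(Λ-span of the x_c) = L · (ideal of the t_c − N c)`** — III §1.4 (5) `i(𝒞) = μ·Λ₀` on the
  `ε`-part, series side).

## References
* E. de Shalit, *Iwasawa theory of elliptic curves with complex multiplication* (1987), Ch. I §3.1, §3.4 Lemma (ii); Ch. II §2.4 (ii), §4.12 (29)–(33);
  Ch. III §1.4 (5), §1.8 (14)–(15), §1.10 (17). [deShalit1987]
* K. Rubin, *The "main conjectures" of Iwasawa theory for imaginary quadratic fields*, Invent. Math. 103 (1991), §4. [Rubin1991]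
-/

noncomputable section

open PowerSeries

namespace Literature.NumberTheory.GaloisRepresentations

/-! ### §1. Generic: endomorphisms commuting with the involution act as scalars on `φ_ε` -/

section DeltaGeneric

variable {R M : Type*} [CommRing R] [AddCommGroup M] [Module R M]
variable (b : Module.Basis (Fin 2) R M) (ε : R) (τ : M →ₗ[R] M) (hτ0 : τ (b 0) = b 1) (hτ1 : τ (b 1) = b 0) (hε : ε * ε = 1)

include hτ0 hτ1 hε in
/-- **`φ_ε(τ m) = ε·φ_ε(m)`** (`φ_ε ∘ (τ − ε) = 0`). [cite: deShalit1987, Ch. I §3.1] -/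
theorem deltaCoinvFun_apply_tau (m : M) : deltaCoinvFun b ε (τ m) = ε * deltaCoinvFun b ε m := by
  have h := LinearMap.congr_fun (deltaCoinvFun_comp_sub_smul_id b ε τ hτ0 hτ1 hε) m
  rw [LinearMap.comp_apply, LinearMap.sub_apply, LinearMap.smul_apply, LinearMap.id_apply, map_sub, map_smul, smul_eq_mul,
    LinearMap.zero_apply, sub_eq_zero] at h
  exact h

include hτ0 hτ1 hε in
/-- ★ **An `R`-linear endomorphism `L` commuting with `τ` acts on `φ_ε` as the SCALAR `φ_ε(L b₀)`**: `φ_ε(L m) = φ_ε(L b₀) · φ_ε(m)` (both sides are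
`R`-linear in `m` and agree on `b₀` (`φ_ε b₀ = 1`) and on `b₁ = τ b₀` (`φ_ε(L τ b₀) = φ_ε(τ L b₀) = ε φ_ε(L b₀)`)). [cite: deShalit1987, Ch. I §3.1] -/
theorem deltaCoinvFun_apply_of_comm (L : M →ₗ[R] M) (hL : L ∘ₗ τ = τ ∘ₗ L) (m : M) :
    deltaCoinvFun b ε (L m) = deltaCoinvFun b ε (L (b 0)) * deltaCoinvFun b ε m := by
  have key : deltaCoinvFun b ε ∘ₗ L = deltaCoinvFun b ε (L (b 0)) • deltaCoinvFun b ε := by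
    refine b.ext fun j => ?_
    fin_cases j
    · simp only [LinearMap.comp_apply, LinearMap.smul_apply, smul_eq_mul]
      rw [show b ⟨0, by omega⟩ = b 0 from rfl, deltaCoinvFun_basis_zero, mul_one]
    · simp only [LinearMap.comp_apply, LinearMap.smul_apply, smul_eq_mul]
      rw [show b ⟨1, by omega⟩ = b 1 from rfl, deltaCoinvFun_basis_one, ← hτ0, ← LinearMap.comp_apply (f := L) (g := τ), hL,
        LinearMap.comp_apply, deltaCoinvFun_apply_tau b ε τ hτ0 hτ1 hε, mul_comm]
  have h := LinearMap.congr_fun key m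
  rw [LinearMap.comp_apply, LinearMap.smul_apply, smul_eq_mul] at h
  exact h

end DeltaGeneric

/-! ### §2. The unit twists are scalars on the `ε`-coinvariants of the Coleman module -/

section Coleman

open GaloisRepresentations.IsNonarchimedeanLocalField LubinTate ValuativeRel

variable {F : Type} [Field F] [ValuativeRel F] [TopologicalSpace F] [IsNonarchimedeanLocalField F]

attribute [local instance] ltNormUniformSpace ltNormIsUniformAddGroup rk1 nF nE fintypeResidueField

variable {π : 𝒪[F]} (hπ : (valuation F).IsUniformizer (π : F)) (hq : residueFieldCard F = 2)
variable {S : Type*} [CommRing S] (ι : LTCoeff F →+* S) [IsAdicComplete (Ideal.span {ι (LTCoeff.of F π)}) S]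
variable (u : (LTCoeff F)ˣ) (hu : LTCoeff.of F π = residueFieldCard F * u) (γ : 𝒪[F]ˣ)
variable (hreg : ∀ x : S, ι (LTCoeff.of F π) * x = 0 → x = 0) (w : 𝒪[F]ˣ) (hγ : (γ : 𝒪[F]) = 1 + π ^ 2 * w)
variable (ε : PowerSeries S) (hε : ε * ε = 1)

include hε in
/-- **`φ_ε(σ_{−1} m) = ε · φ_ε(m)`.** [cite: deShalit1987, Ch. I §3.1; Ch. III §1.8 (14)] -/
theorem colemanDeltaCoinvFun_unitTwistₗ_neg_one (m : ColemanCoordModule hπ hq ι u hu γ) :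
    colemanDeltaCoinvFun hπ hq ι u hu γ hreg w hγ ε (unitTwistₗ hπ hq ι u hu γ (-1) m) = ε * colemanDeltaCoinvFun hπ hq ι u hu γ hreg w hγ ε m :=
  deltaCoinvFun_apply_tau _ ε _ (unitTwistₗ_neg_one_coordBasisDelta_zero hπ hq ι u hu γ hreg w hγ)
    (unitTwistₗ_neg_one_coordBasisDelta_one hπ hq ι u hu γ hreg w hγ) hε m

include hε in
/-- ★★ **Every unit twist is a SCALAR on the `ε`-coinvariants: `φ_ε(σ_v r) = φ_ε(σ_v 1) · φ_ε(r)`** (`σ_v` is `Λ`-linear and commutes with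
`σ_{−1}`; the coinvariants are free of rank one on the class of `1`). [cite: deShalit1987, Ch. I §3.1, §3.4 Lemma (ii); Ch. III §1.8 (14)] -/
theorem colemanDeltaCoinvFun_unitTwistₗ (v : 𝒪[F]ˣ) (r : ColemanCoordModule hπ hq ι u hu γ) :
    colemanDeltaCoinvFun hπ hq ι u hu γ hreg w hγ ε (unitTwistₗ hπ hq ι u hu γ v r) =
      colemanDeltaCoinvFun hπ hq ι u hu γ hreg w hγ ε (unitTwistₗ hπ hq ι u hu γ v (TActModule.ofPS _ _ 1)) *
        colemanDeltaCoinvFun hπ hq ι u hu γ hreg w hγ ε r := by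
  rw [← coordBasisDelta_zero hπ hq ι u hu γ hreg w hγ]
  exact deltaCoinvFun_apply_of_comm _ ε _ (unitTwistₗ_neg_one_coordBasisDelta_zero hπ hq ι u hu γ hreg w hγ)
    (unitTwistₗ_neg_one_coordBasisDelta_one hπ hq ι u hu γ hreg w hγ) hε _ (unitTwistₗ_comm hπ hq ι u hu γ v (-1)) r

/-- `t_1 = φ_ε(σ_1 1) = 1`. [cite: deShalit1987, Ch. I §3.1] -/
theorem colemanDeltaCoinvFun_unitTwistₗ_one_one :
    colemanDeltaCoinvFun hπ hq ι u hu γ hreg w hγ ε (unitTwistₗ hπ hq ι u hu γ 1 (TActModule.ofPS _ _ 1)) = 1 := by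
  rw [unitTwistₗ_one, LinearMap.id_apply, ← coordBasisDelta_zero hπ hq ι u hu γ hreg w hγ, deltaCoinvFun_basis_zero]

include hε in
/-- `t_{−1} = φ_ε(σ_{−1} 1) = ε`. [cite: deShalit1987, Ch. I §3.1] -/
theorem colemanDeltaCoinvFun_unitTwistₗ_neg_one_one :
    colemanDeltaCoinvFun hπ hq ι u hu γ hreg w hγ ε (unitTwistₗ hπ hq ι u hu γ (-1) (TActModule.ofPS _ _ 1)) = ε := by
  rw [colemanDeltaCoinvFun_unitTwistₗ_neg_one hπ hq ι u hu γ hreg w hγ ε hε, ← coordBasisDelta_zero hπ hq ι u hu γ hreg w hγ, deltaCoinvFun_basis_zero,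
    mul_one]

/-- ★ **`t_γ = φ_ε(σ_γ 1) = 1 + T`** (`σ_γ = (1+T)•`): the distinguished unit is the variable. [cite: deShalit1987, Ch. I §3.1] -/
theorem colemanDeltaCoinvFun_unitTwistₗ_self_one :
    colemanDeltaCoinvFun hπ hq ι u hu γ hreg w hγ ε (unitTwistₗ hπ hq ι u hu γ γ (TActModule.ofPS _ _ 1)) = 1 + PowerSeries.X := by
  rw [unitTwistₗ_self, map_smul, ← coordBasisDelta_zero hπ hq ι u hu γ hreg w hγ, deltaCoinvFun_basis_zero, smul_eq_mul, mul_one]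

/-- **`t_{γ^n} = (1+T)^n`.** [cite: deShalit1987, Ch. I §3.1] -/
theorem colemanDeltaCoinvFun_unitTwistₗ_pow_one (n : ℕ) :
    colemanDeltaCoinvFun hπ hq ι u hu γ hreg w hγ ε (unitTwistₗ hπ hq ι u hu γ (γ ^ n) (TActModule.ofPS _ _ 1)) = (1 + PowerSeries.X) ^ n := by
  rw [unitTwistₗ_pow, map_smul, ← coordBasisDelta_zero hπ hq ι u hu γ hreg w hγ, deltaCoinvFun_basis_zero, smul_eq_mul, mul_one]

include hε in
/-- **`t_{vv′} = t_v · t_{v′}`**: `v ↦ t_v^ε` is a homomorphism `𝒪_F^× → Λ^×`-valued (the character `Λ(𝒢) → Λ` of the `ε`-part). [cite: deShalit1987, Ch. I §3.1] -/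
theorem colemanDeltaCoinvFun_unitTwistₗ_mul_one (v v' : 𝒪[F]ˣ) :
    colemanDeltaCoinvFun hπ hq ι u hu γ hreg w hγ ε (unitTwistₗ hπ hq ι u hu γ (v * v') (TActModule.ofPS _ _ 1)) =
      colemanDeltaCoinvFun hπ hq ι u hu γ hreg w hγ ε (unitTwistₗ hπ hq ι u hu γ v (TActModule.ofPS _ _ 1)) *
        colemanDeltaCoinvFun hπ hq ι u hu γ hreg w hγ ε (unitTwistₗ hπ hq ι u hu γ v' (TActModule.ofPS _ _ 1)) := by
  rw [unitTwistₗ_mul, LinearMap.comp_apply, colemanDeltaCoinvFun_unitTwistₗ hπ hq ι u hu γ hreg w hγ ε hε]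

include hε in
/-- **`φ_ε((σ_v − N) r) = (t_v − N) · φ_ε(r)`** for a scalar `N ∈ Λ` (e.g. `N = N𝔞`). [cite: deShalit1987, Ch. II §4.12 (29)] -/
theorem colemanDeltaCoinvFun_unitTwistₗ_sub_smul (v : 𝒪[F]ˣ) (N : PowerSeries S) (r : ColemanCoordModule hπ hq ι u hu γ) :
    colemanDeltaCoinvFun hπ hq ι u hu γ hreg w hγ ε (unitTwistₗ hπ hq ι u hu γ v r - N • r) =
      (colemanDeltaCoinvFun hπ hq ι u hu γ hreg w hγ ε (unitTwistₗ hπ hq ι u hu γ v (TActModule.ofPS _ _ 1)) - N) *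
        colemanDeltaCoinvFun hπ hq ι u hu γ hreg w hγ ε r := by
  rw [map_sub, map_smul, colemanDeltaCoinvFun_unitTwistₗ hπ hq ι u hu γ hreg w hγ ε hε, smul_eq_mul, sub_mul]

/-! ### §4. The cocycle relation of de Shalit II §2.4 (ii) in `Λ`, and its division (II §4.12 (32)–(33)) -/

include hε in
/-- ★★ **THE COCYCLE RELATION IN `Λ`**: if `x : I → M` satisfies `σ_{v c}(x a) + N a • x c = σ_{v a}(x c) + N c • x a` for all `a, c` (de Shalit II §2.4 (ii),
written additively: `(σ_𝔠 − N𝔠)·e(𝔞) = (σ_𝔞 − N𝔞)·e(𝔠)`), then **`(t_{v c} − N c)·φ_ε(x a) = (t_{v a} − N a)·φ_ε(x c)`**.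
[cite: deShalit1987, Ch. II §2.4 (ii), §4.12 (29)–(31)] -/
theorem colemanDeltaCoinvFun_cocycle {I : Type*} (x : I → ColemanCoordModule hπ hq ι u hu γ) (v : I → 𝒪[F]ˣ) (N : I → PowerSeries S)
    (hrel : ∀ a c : I, unitTwistₗ hπ hq ι u hu γ (v c) (x a) + N a • x c = unitTwistₗ hπ hq ι u hu γ (v a) (x c) + N c • x a) (a c : I) :
    (colemanDeltaCoinvFun hπ hq ι u hu γ hreg w hγ ε (unitTwistₗ hπ hq ι u hu γ (v c) (TActModule.ofPS _ _ 1)) - N c) *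
        colemanDeltaCoinvFun hπ hq ι u hu γ hreg w hγ ε (x a) =
      (colemanDeltaCoinvFun hπ hq ι u hu γ hreg w hγ ε (unitTwistₗ hπ hq ι u hu γ (v a) (TActModule.ofPS _ _ 1)) - N a) *
        colemanDeltaCoinvFun hπ hq ι u hu γ hreg w hγ ε (x c) := by
  have h : unitTwistₗ hπ hq ι u hu γ (v c) (x a) - N c • x a = unitTwistₗ hπ hq ι u hu γ (v a) (x c) - N a • x c := by
    rw [sub_eq_sub_iff_add_eq_add, hrel]
  have h2 := congrArg (colemanDeltaCoinvFun hπ hq ι u hu γ hreg w hγ ε) h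
  rwa [colemanDeltaCoinvFun_unitTwistₗ_sub_smul hπ hq ι u hu γ hreg w hγ ε hε, colemanDeltaCoinvFun_unitTwistₗ_sub_smul hπ hq ι u hu γ hreg w hγ ε hε]
    at h2

include hε in
/-- ★★ **DIVISION** (de Shalit II §4.12 (32)–(33) on the series side): under the cocycle relation, if for ONE index `a₁` the element `t_{v a₁} − N a₁` is
a non-zero-divisor of `Λ` and divides `φ_ε(x a₁)` with quotient `L` — `φ_ε(x a₁) = (t_{v a₁} − N a₁)·L` — then **`φ_ε(x c) = (t_{v c} − N c)·L` for EVERY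
`c`**. [cite: deShalit1987, Ch. II §4.12 (32)–(33)] -/
theorem colemanDeltaCoinvFun_eq_mul_of_divides {I : Type*} (x : I → ColemanCoordModule hπ hq ι u hu γ) (v : I → 𝒪[F]ˣ) (N : I → PowerSeries S)
    (hrel : ∀ a c : I, unitTwistₗ hπ hq ι u hu γ (v c) (x a) + N a • x c = unitTwistₗ hπ hq ι u hu γ (v a) (x c) + N c • x a)
    (a₁ : I) (L : PowerSeries S)
    (hreg₁ : colemanDeltaCoinvFun hπ hq ι u hu γ hreg w hγ ε (unitTwistₗ hπ hq ι u hu γ (v a₁) (TActModule.ofPS _ _ 1)) - N a₁ ∈ nonZeroDivisors (PowerSeries S))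
    (hL : colemanDeltaCoinvFun hπ hq ι u hu γ hreg w hγ ε (x a₁) =
      (colemanDeltaCoinvFun hπ hq ι u hu γ hreg w hγ ε (unitTwistₗ hπ hq ι u hu γ (v a₁) (TActModule.ofPS _ _ 1)) - N a₁) * L) (c : I) :
    colemanDeltaCoinvFun hπ hq ι u hu γ hreg w hγ ε (x c) =
      (colemanDeltaCoinvFun hπ hq ι u hu γ hreg w hγ ε (unitTwistₗ hπ hq ι u hu γ (v c) (TActModule.ofPS _ _ 1)) - N c) * L := by
  have h := colemanDeltaCoinvFun_cocycle hπ hq ι u hu γ hreg w hγ ε hε x v N hrel a₁ c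
  rw [hL, ← mul_assoc, mul_comm _ (colemanDeltaCoinvFun hπ hq ι u hu γ hreg w hγ ε
    (unitTwistₗ hπ hq ι u hu γ (v a₁) (TActModule.ofPS _ _ 1)) - N a₁), mul_assoc] at h
  exact (mul_cancel_left_mem_nonZeroDivisors hreg₁).mp h.symm

include hε in
/-- ★ **`φ_ε` of the `Λ`-span of the family is `L` times the ideal of the `t_{v c} − N c`** (de Shalit III §1.4 (5): `i(𝒞) = μ(𝔣)·Λ₀` — on the `ε`-part,
series side): under the hypotheses of `colemanDeltaCoinvFun_eq_mul_of_divides`,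
`φ_ε(span {x c}) = span {(t_{v c} − N c) · L}`. [cite: deShalit1987, Ch. III §1.4 (5); Ch. II §4.12 (33)] -/
theorem colemanDeltaCoinvFun_map_span_range_eq_span_mul {I : Type*} (x : I → ColemanCoordModule hπ hq ι u hu γ) (v : I → 𝒪[F]ˣ) (N : I → PowerSeries S)
    (hrel : ∀ a c : I, unitTwistₗ hπ hq ι u hu γ (v c) (x a) + N a • x c = unitTwistₗ hπ hq ι u hu γ (v a) (x c) + N c • x a)
    (a₁ : I) (L : PowerSeries S)
    (hreg₁ : colemanDeltaCoinvFun hπ hq ι u hu γ hreg w hγ ε (unitTwistₗ hπ hq ι u hu γ (v a₁) (TActModule.ofPS _ _ 1)) - N a₁ ∈ nonZeroDivisors (PowerSeries S))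
    (hL : colemanDeltaCoinvFun hπ hq ι u hu γ hreg w hγ ε (x a₁) =
      (colemanDeltaCoinvFun hπ hq ι u hu γ hreg w hγ ε (unitTwistₗ hπ hq ι u hu γ (v a₁) (TActModule.ofPS _ _ 1)) - N a₁) * L) :
    (Submodule.span (PowerSeries S) (Set.range x)).map (colemanDeltaCoinvFun hπ hq ι u hu γ hreg w hγ ε) =
      Ideal.span (Set.range fun c =>
        (colemanDeltaCoinvFun hπ hq ι u hu γ hreg w hγ ε (unitTwistₗ hπ hq ι u hu γ (v c) (TActModule.ofPS _ _ 1)) - N c) * L) := by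
  have hfun : (⇑(colemanDeltaCoinvFun hπ hq ι u hu γ hreg w hγ ε) ∘ x) = fun c =>
      (colemanDeltaCoinvFun hπ hq ι u hu γ hreg w hγ ε (unitTwistₗ hπ hq ι u hu γ (v c) (TActModule.ofPS _ _ 1)) - N c) * L :=
    funext fun c => colemanDeltaCoinvFun_eq_mul_of_divides hπ hq ι u hu γ hreg w hγ ε hε x v N hrel a₁ L hreg₁ hL c
  rw [Submodule.map_span, ← Set.range_comp, hfun]

end Coleman

/-! ### §3. The weight values of the twist scalars: `t_v(a_k) = v^{k+1}` -/

section Weights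

open GaloisRepresentations.IsNonarchimedeanLocalField LubinTate ValuativeRel Field

variable {F : Type} [Field F] [ValuativeRel F] [TopologicalSpace F] [IsNonarchimedeanLocalField F]

attribute [local instance] ltNormUniformSpace ltNormIsUniformAddGroup rk1 nF nE fintypeResidueField

variable {π : 𝒪[F]} (hπ : (valuation F).IsUniformizer (π : F))
variable (E : IntermediateField F (AlgebraicClosure F)) [FiniteDimensional F E]
variable (hq : residueFieldCard F = 2) (u : (LTCoeff F)ˣ) (hu : LTCoeff.of F π = residueFieldCard F * u) (γ : 𝒪[F]ˣ)
variable [IsAdicComplete (Ideal.span {algebraMap (LTCoeff F) (unitBall E) (LTCoeff.of F π)}) (unitBall E)]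
variable (hreg : ∀ x : unitBall E, algebraMap (LTCoeff F) (unitBall E) (LTCoeff.of F π) * x = 0 → x = 0)
  (w : 𝒪[F]ˣ) (hγ : (γ : 𝒪[F]) = 1 + π ^ 2 * w)

include hu in
/-- ★ **`t_v^ε(a_k) · mom_k(1) = v^{k+1} · mom_k(1)`**, `ε = (−1)^{k+1}`, `a_k = γ^{k+1} − 1`: the weight values of the twist scalars (both sides are
`mom_k(σ_v 1)`: `coordMoment_unitTwistₗ` and `coordMoment_eq_tEval_colemanDeltaCoinvFun`). [cite: deShalit1987, Ch. I §3.1, §3.5 (ii)] -/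
theorem tEval_colemanDeltaCoinvFun_unitTwistₗ_one_mul (k : ℕ) (v : 𝒪[F]ˣ) :
    tEval (algebraMap_unit_pow_sub_one_mem hπ E hq γ k)
        (colemanDeltaCoinvFun hπ hq (algebraMap (LTCoeff F) (unitBall E)) u hu γ hreg w hγ ((-1) ^ (k + 1))
          (unitTwistₗ hπ hq (algebraMap (LTCoeff F) (unitBall E)) u hu γ v (TActModule.ofPS _ _ 1))) * coordMoment hπ E u k 1 =
      algebraMap 𝒪[F] (unitBall E) (v : 𝒪[F]) ^ (k + 1) * coordMoment hπ E u k 1 := by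
  rw [← coordMoment_eq_tEval_colemanDeltaCoinvFun hπ E hq u hu γ hreg w hγ, coordMoment_unitTwistₗ hπ E hq u hu γ, TActModule.toPS_ofPS]

include hu in
/-- **`t_v^ε(a_k) = v^{k+1}`** at every weight where `mom_k(1)` is a non-zero-divisor (`k = 0, 1` e.g.: `mom_0(1) = 1`, `mom_1(1) = u⁻¹`).
[cite: deShalit1987, Ch. I §3.1, §3.5 (ii)] -/
theorem tEval_colemanDeltaCoinvFun_unitTwistₗ_one (k : ℕ) (hk : coordMoment hπ E u k 1 ∈ nonZeroDivisors (unitBall E)) (v : 𝒪[F]ˣ) :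
    tEval (algebraMap_unit_pow_sub_one_mem hπ E hq γ k)
        (colemanDeltaCoinvFun hπ hq (algebraMap (LTCoeff F) (unitBall E)) u hu γ hreg w hγ ((-1) ^ (k + 1))
          (unitTwistₗ hπ hq (algebraMap (LTCoeff F) (unitBall E)) u hu γ v (TActModule.ofPS _ _ 1))) =
      algebraMap 𝒪[F] (unitBall E) (v : 𝒪[F]) ^ (k + 1) :=
  (mul_cancel_right_mem_nonZeroDivisors hk).mp (tEval_colemanDeltaCoinvFun_unitTwistₗ_one_mul hπ E hq u hu γ hreg w hγ k v)

include hu in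
/-- ★ **The weight values of the divided element** (de Shalit II §4.12 (31) on the series side): if `φ_ε(x) = (t_v − N)·L` (`ε = (−1)^{k+1}`) then
**`(v^{k+1} − N(a_k)) · L(a_k) · mom_k(1) = mom_k(x)`** — for `x = Col(e(𝔠))` the right side is the Coates–Wiles value of the elliptic unit.
[cite: deShalit1987, Ch. II §4.12 (29)–(31)] -/
theorem tEval_mul_coordMoment_one_eq_of_eq_mul (k : ℕ) (v : 𝒪[F]ˣ) (N L : PowerSeries (unitBall E))
    (x : ColemanCoordModule hπ hq (algebraMap (LTCoeff F) (unitBall E)) u hu γ)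
    (hx : colemanDeltaCoinvFun hπ hq (algebraMap (LTCoeff F) (unitBall E)) u hu γ hreg w hγ ((-1) ^ (k + 1)) x =
      (colemanDeltaCoinvFun hπ hq (algebraMap (LTCoeff F) (unitBall E)) u hu γ hreg w hγ ((-1) ^ (k + 1))
        (unitTwistₗ hπ hq (algebraMap (LTCoeff F) (unitBall E)) u hu γ v (TActModule.ofPS _ _ 1)) - N) * L) :
    (algebraMap 𝒪[F] (unitBall E) (v : 𝒪[F]) ^ (k + 1) - tEval (algebraMap_unit_pow_sub_one_mem hπ E hq γ k) N) *
        tEval (algebraMap_unit_pow_sub_one_mem hπ E hq γ k) L * coordMoment hπ E u k 1 =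
      coordMoment hπ E u k (TActModule.toPS x) := by
  have hsub : tEval (algebraMap_unit_pow_sub_one_mem hπ E hq γ k)
      (colemanDeltaCoinvFun hπ hq (algebraMap (LTCoeff F) (unitBall E)) u hu γ hreg w hγ ((-1) ^ (k + 1))
        (unitTwistₗ hπ hq (algebraMap (LTCoeff F) (unitBall E)) u hu γ v (TActModule.ofPS _ _ 1)) - N) =
      tEval (algebraMap_unit_pow_sub_one_mem hπ E hq γ k)
        (colemanDeltaCoinvFun hπ hq (algebraMap (LTCoeff F) (unitBall E)) u hu γ hreg w hγ ((-1) ^ (k + 1))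
          (unitTwistₗ hπ hq (algebraMap (LTCoeff F) (unitBall E)) u hu γ v (TActModule.ofPS _ _ 1))) -
      tEval (algebraMap_unit_pow_sub_one_mem hπ E hq γ k) N := map_sub (tEvalHom (algebraMap_unit_pow_sub_one_mem hπ E hq γ k)) _ _
  have ht := tEval_colemanDeltaCoinvFun_unitTwistₗ_one_mul hπ E hq u hu γ hreg w hγ k v
  rw [coordMoment_eq_tEval_colemanDeltaCoinvFun hπ E hq u hu γ hreg w hγ, hx, tEval_mul, hsub]
  linear_combination (-(tEval (algebraMap_unit_pow_sub_one_mem hπ E hq γ k) L)) * ht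

end Weights

end Literature.NumberTheory.GaloisRepresentations
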